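import Summits.CriticalPhenomena.Ising3DConformalLimit.Theorems.EnergyNotSigmaSquaredGapForcesFarMergingScreeningDefsAnnular

/-!
# Annular domination split into TILTED BLOCKING CONTROL and UN-TILTING
(line `screening-form-lemma-a1` of crux `GapForcesFarMerging`, item stmt-CriticalPhenomena-4468, route `EnergyNotSigmaSquared`;
lead seat a1; helper file of the open stub `stub_annularDomination : AnnularDomination`, currency of
`Theorems/EnergyNotSigmaSquaredGapForcesFarMergingScreeningDefsAnnular.lean`)

By the landed drop identity (`screening_drop_eq_defect`, …FloorsAux.lean) the octave drop of the one-pinch screening ladder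
`A(2^k;M) − A(2^(k+1);M) = E[W_k · H^conf_k]` is the mean, TILTED by the screening weight
`W_k = screenWeight n 2^k 0 e₂ (dn M) = 𝟙[e₂,dn M ∉ C]·S(C_(2^k))`, of the hazard of the new piece `C_(2^(k+1)) ∖ C_(2^k)`
for the probe system CONFINED off the inner cluster; the conclusion of `AnnularDomination` is the UNtilted, UNconfined
annular hazard `1 − annScreen = E[1 − annWeight]`. The lead's exact enumeration (Cruxes/GapForcesFarMerging/AD-ANALYSIS.md)
shows that the screening ratio of the Ising model is neither subadditive nor supermultiplicative in the obstacle
(cooperative blocking: the confined hazard is not controlled by the free one, pointwise), so `AnnularDomination` has two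
logically distinct parts, separated by the intermediate quantity `E[W_k · (1 − annWeight_k)]` (the TILTED FREE annular hazard):

* (B) TILTED BLOCKING CONTROL — `E[W_k H^conf_k] ≥ c·E[W_k] ⟹ E[W_k (1 − annWeight_k)] ≥ ν(c)·E[W_k]`: under the
  screening tilt, a drop of the ladder is not entirely cooperative blocking / re-entrance — the annular piece ALONE cuts a
  free probe with comparable tilted probability (a statement about the geometry of the tilted cluster; no analogue in print);
* (H) UN-TILTING — `E[W_k (1 − annWeight_k)] ≥ ν·E[W_k], E[W_k] > 0 ⟹ 1 − annScreen ≥ μ(ν)`: the screening tilt `W_k`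
  (a DECREASING function of the cluster) cannot inflate a small untilted annular hazard (an INCREASING function of the cluster)
  into a large tilted one — Harris' inequality `E[W·G] ≤ E[W]·E[G]` would give it with `μ = ν` if the one-strand trace law
  were positively associated (it is not in general: lead c1's 4-cycle); qualitatively it is an inner/outer mixing statement
  for the sourced cluster under conditioning, of the type of Aizenman–Duminil-Copin 2021 §6 (`d = 4`).
This file proves the bookkeeping `(B) → (H) → AnnularDomination` (octave and bulk forms), so that the registered skeleton can
carry (B) and (H) as separate stubs. [folklore]
-/

noncomputable section

namespace Summit.CriticalPhenomena.Ising3DConformalLimit.EnergyNotSigmaSquaredGapForcesFarMerging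

open scoped symmDiff ENNReal
open MeasureTheory Filter Finset
open Literature.Probability.LatticeModels Literature.Probability.Percolation
open Summit.CriticalPhenomena.Ising3DConformalLimit.Theorems.GapForcesFarMerging.Negative
  (e₁ e₂ cc2 xR up dn FarMergingShape SinglePinchLawShape)
open Summit.CriticalPhenomena.Ising3DConformalLimit.GapForcesFarMergingScreening

/-- **`AnnularDomination` from tilted blocking control (B) and un-tilting (H)** — pure filter bookkeeping: given a drop
`c`, (B) yields a tilted free annular hazard `≥ ν(c)` at every opaque octave (bulk) step, and (H) turns it into an untilted
annular (outer) screening drop `μ(ν)`. [folklore] -/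
theorem annularDomination_of_blocking_untilt :
    (∀ c : ℝ, 0 < c → ∃ ν : ℝ, 0 < ν ∧ (∀ᶠ k : ℕ in atTop, ∀ K : ℕ, k < K → ∀ᶠ n : ℕ in atTop, (0 < pinchScreen n (2 ^ k) (2 ^ (K + 3)) ∧ pinchScreen n (2 ^ (k + 1)) (2 ^ (K + 3)) ≤ (1 - c) * pinchScreen n (2 ^ k) (2 ^ (K + 3))) → ν * pinchScreen n (2 ^ k) (2 ^ (K + 3)) ≤ ∫ ω, screenWeight n (2 ^ k) 0 e₂ (dn (2 ^ (K + 3))) ω * (1 - annWeight n k 0 e₂ (dn (2 ^ (K + 3))) ω) ∂(sourcedDoubleCurrentLaw 3 n (criticalBeta 3) ({0} ∆ {up (2 ^ (K + 3))}) ∅)) ∧ (∀ᶠ K : ℕ in atTop, ∀ᶠ n : ℕ in atTop, (0 < pinchScreen n (2 ^ K) (2 ^ (K + 3)) ∧ pinchScreen n n (2 ^ (K + 3)) ≤ (1 - c) * pinchScreen n (2 ^ K) (2 ^ (K + 3))) → ν * pinchScreen n (2 ^ K) (2 ^ (K + 3)) ≤ ∫ ω, screenWeight n (2 ^ K) 0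 e₂ (dn (2 ^ (K + 3))) ω * (1 - outerWeight n K 0 e₂ (dn (2 ^ (K + 3))) ω) ∂(sourcedDoubleCurrentLaw 3 n (criticalBeta 3) ({0} ∆ {up (2 ^ (K + 3))}) ∅))) →
    (∀ ν : ℝ, 0 < ν → ∃ μ : ℝ, 0 < μ ∧ (∀ᶠ k : ℕ in atTop, ∀ K : ℕ, k < K → ∀ᶠ n : ℕ in atTop, 0 < pinchScreen n (2 ^ k) (2 ^ (K + 3)) → ν * pinchScreen n (2 ^ k) (2 ^ (K + 3)) ≤ ∫ ω, screenWeight n (2 ^ k) 0 e₂ (dn (2 ^ (K + 3))) ω * (1 - annWeight n k 0 e₂ (dn (2 ^ (K + 3))) ω) ∂(sourcedDoubleCurrentLaw 3 n (criticalBeta 3) ({0} ∆ {up (2 ^ (K + 3))}) ∅) → annScreen n k 0 (up (2 ^ (K + 3))) e₂ (dn (2 ^ (K + 3))) ≤ 1 - μ) ∧ (∀ᶠ K : ℕ in atTop, ∀ᶠ n : ℕ in atTop, 0 < pinchScreen n (2 ^ K) (2 ^ (K + 3)) → ν * pinchScreen n (2 ^ K) (2 ^ (K + 3)) ≤ ∫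 ω, screenWeight n (2 ^ K) 0 e₂ (dn (2 ^ (K + 3))) ω * (1 - outerWeight n K 0 e₂ (dn (2 ^ (K + 3))) ω) ∂(sourcedDoubleCurrentLaw 3 n (criticalBeta 3) ({0} ∆ {up (2 ^ (K + 3))}) ∅) → outerScreen n K 0 (up (2 ^ (K + 3))) e₂ (dn (2 ^ (K + 3))) ≤ 1 - μ)) →
    AnnularDomination := by
  intro hB hH c hc
  obtain ⟨ν, hν, hBo, hBb⟩ := hB c hc
  obtain ⟨μ, hμ, hHo, hHb⟩ := hH ν hν
  refine ⟨μ, hμ, ?_, ?_⟩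
  · filter_upwards [hBo, hHo] with k hBk hHk K hkK
    filter_upwards [hBk K hkK, hHk K hkK] with n hBn hHn hyp
    exact hHn hyp.1 (hBn hyp)
  · filter_upwards [hBb, hHb] with K hBK hHK
    filter_upwards [hBK, hHK] with n hBn hHn hyp
    exact hHn hyp.1 (hBn hyp)

end Summit.CriticalPhenomena.Ising3DConformalLimit.EnergyNotSigmaSquaredGapForcesFarMerging

end
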